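import Summits.QuantumFields.YangMills.Theorems.BalabanUVNodesN15NeumannCubeLiftRows
import Summits.QuantumFields.YangMills.Theorems.BalabanUVNodesN15NeumannCubeLiftConvolution
import Summits.QuantumFields.YangMills.Theorems.BalabanUVNodesN15NeumannCubeLiftNonlocalDefect
import Summits.QuantumFields.YangMills.Theorems.BalabanUVNodesN15TwoSpacingGluingNeumannRemainder
import Summits.QuantumFields.YangMills.Theorems.BalabanUVNodesN15TwoSpacingGluingDirichlet
import Summits.QuantumFields.YangMills.Theorems.BalabanUVNodesN15TwoSpacingGluingCommutator
import HarnessLib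

/-!
# Route «BalabanUVNodes» (K3⁸), node N15 = NE2, PROGRAMME P (dag-n15-a §MAP (D)): ENTRY 3 OF THE LIFTED NEUMANN CUBE PROPAGATOR ON THE TORUS FAMILY OF RECORD —
# the WEIGHTED row `M_h∘(Σ_μ∇*_μ∇_μ)∘G^{↑}(□ + c)` at both spacings and its two-grid η-defect, for a GENERIC cube-interior weight `h` (cube side `L^s` FIXED, volume `2L^{m_T}` FREE)

Cell `pub-ymgap`, seat `pub-ymgap-dag-n15-w5` (WIDTH SEAT w5 on node n15, g4; HUMAN RULING D-0062 ∕ director-ym R399 (3a)); `--kind proof --supports stmt-QuantumFields-27366 --as helper`,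
COUNT-NEUTRAL.  Theorems only (0 `def`, 0 `sorry`).  Imports BY NAME dag-n15-a's PROGRAMME P — P-IIb `…NeumannCubeLiftRows` (`mulOp_comp_deltaOp_comp_liftCubeG`: the EXACT locality on the big
torus), P-IIe `…NeumannCubeLiftConvolution` (`hasMaj_chiCube_comp_liftCubeG_of`: (β′), any big-torus operator behind the lifted cube), P-IIi `…NeumannCubeLiftNonlocalDefect`
(`hasMaj_idef_chiCube_nonlocal_liftCubeG`: the η-defect behind `N_L = a•Q*Q − ∂Π∂*`, hypothesis-free) — and dag-n15-c's FILE 69 `…TwoSpacingGluingNeumannRemainder` (`deltaOp_eq_lapOp_zero_add`,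
`hasMaj_nonlocalPart`, `hasMaj_rate_le`), FILE 47 `…TwoSpacingGluingDirichlet` (`hasMaj_localize_sandwich`, `hasMaj_localize_idef_sandwich`), FILE 46 `…TwoSpacingGluingCommutator` (`lapOp`,
`hasMaj_idef_mulOp_comp_loc`); nothing in the tree is modified or re-proved.

WHAT.  Big torus `Tor (fine n M)`, cube torus `M′_ν = 2S ∣ M_ν`, lifted cube propagator `G^{↑}(□ + c) = liftCubeG n hM c S a` (P-IIa), the local Laplacian `Σ_μ∇*_μ∇_μ = lapOp n (bshiftEquiv M n) 0
= Δ_a − N_L`, `N_L = a•Q*Q − ∂Π∂*` (FILE 69), and a weight `h` supported on the cube's INTERIOR bonds `intBonds M n c S` with `|h| ≤ 1` (dag-n15-c's partition member `h_k` is one such):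
* §1 `mulOp_comp_mulOp_chiCube_of_intBonds`, `mulOp_chiCube_sandwich_of_intBonds` (`M_hM_{χ_□} = M_h = M_{χ_□}M_hM_{χ_□}`); ★★ `mulOp_comp_lapOp_comp_liftCubeG` — THE ENTRY-3 IDENTITY ON THE BIG
  TORUS: `M_h∘(Σ∇*∇)∘G^{↑}(□ + c) = M_h − M_h∘(M_{χ_□}∘N_L∘G^{↑}(□ + c))` (FILE 86 `mulOp_coverH_comp_lapOp_comp_knitG`'s twin: P-IIb's exact locality replaces N-IIIa's);
* §2 ★ `hasMaj_mulOp_loc_of_intBonds` (`M_h ≤ 1_□(y)1_□(y′)e^{−δd}`), ★★ `hasMaj_mulOp_lap_liftCubeG_of` — THE WEIGHTED ENTRY-3 ROW with letters displayed (cube-torus `G′ ≤ Ce^{−δ₀d′}`, big-torus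
  `N_L ≤ c_Ne^{−ρ₁d}`, row sum `c_r` at `σ`, `ρ ≤ δ₀`, `ρ + σ ≤ ρ₁`): `M_h∘(Σ∇*∇)∘G^{↑} ≤ 1_□1_□·(1 + 2^{d+1}c_N(Ce^{δ₀})c_r)·e^{−ρd}`, ANY spacing `n ≥ 1` (FILE 86 `hasMaj_mulOp_coverH_lap_knitG`'s
  twin: P-IIe (β′) replaces N-IIi); ★★★ `hasMaj_mulOp_lap_liftCubeG_pair` — on the family of record `M = MP (paramsOf d L m_T K hL)`, cube torus `MP (paramsOf d L s K hL)`, BOTH spacings `L^K` and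
  `L^r·L^K`, EVERY letter DISCHARGED (`ineq110_114_pair` at the cube torus, `hasMaj_landauRe` + `hasMaj_nonlocalPart` on the big torus, `rowSum_unitTorusGeo`), `δ, β₃` free of `s, m_T, K, r, c, h`;
* §3 ★★★ `hasMaj_idef_mulOp_lap_liftCubeG` — THE TWO-GRID η-DEFECT OF THE WEIGHTED ROW for a coarse weight `h` and a fine weight `h′` with the fit `|h′ − h∘P| ≤ o`:
  `𝔇(M_{h′}(Σ∇′*∇′)G′^{↑}, M_h(Σ∇*∇)G^{↑}) ≤ 1_□1_□·m₃·(o + (L^K)^{−γ∕2})·e^{−δd}`, `0 < γ < 1` (FILE 88 `hasMaj_idef_mulOp_coverH_lap_knitG`'s twin: P-IIi replaces FILE 80 ∕ N-IIm).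
WHY (dag-n15-a §MAP (D), dag-n15-c 86R∕88R).  `ρ(sLap)` descends, but its transplant is not needed: the identity of §1 holds verbatim on the torus of record, so the entry-3 rows∕defect of the
record knit's cubes (`knitGR … k = liftCubeG …`, FILE 73) are these theorems at `h := knitHR … k` — no cover geometry enters here (generic `h`).
HONEST FRAMING.  Count-neutral helper rows; finite lattice algebra + block-majorant bookkeeping over LANDED rows (no new analytic estimate); `U ≡ 1` doubled-cube torus MODEL of [B5] §1 lifted
to the torus of record; nothing of [B5] Prop. 1.2 ∕ [B6] (2.38)–(2.40), (2.133)–(2.136) ∕ [B9] Thm 3.14 asserted (shapes only); NE2⁺ NOT PRINTED ∕ NOT proved; N15 NOT discharged; K3⁸ OPEN;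
counts UNMOVED (typed 28∕28 · discharged 5∕27); one finite 𝕋⁴ at fixed ε per index — NOT infinite volume ∕ ℝ⁴ ∕ OS ∕ mass gap ∕ Clay; R4 closes the conditional finite-𝕋⁴ rung
`BalabanLadder.UV` only.  No summit statement is proved here.  Restate-immune (no Theses import).
-/

noncomputable section

open scoped BigOperators Matrix
open Finset

namespace Summit.QuantumFields.YangMills.BalabanUVNodes.N15.TwoGrid

open Real
open Literature.MathematicalPhysics.QuantumFieldTheory.Balaban1983to89
open Literature.MathematicalPhysics.QuantumFieldTheory.Balaban1983to89.B5Prop11Plancherel (Tor fine)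
open Literature.MathematicalPhysics.QuantumFieldTheory.Balaban1983to89.B5SiteBridgeP12 (MP)
open Literature.MathematicalPhysics.QuantumFieldTheory.Balaban1983to89.B6Prop26Gluing (mulOp mulOp_apply ind ind_nonneg ind_le_one)
open Literature.MathematicalPhysics.QuantumFieldTheory.King1986.Torus (blockOf tdistT tdistT_nonneg)
open Literature.MathematicalPhysics.QuantumFieldTheory.Balaban1983to89.B11SectG (BlockNorm HasMaj RowSum)
open Literature.MathematicalPhysics.QuantumFieldTheory.Balaban1983to89.B6RandomWalk (Triangle254)
open Literature.MathematicalPhysics.QuantumFieldTheory.Balaban1983to89.B6UnitTorusCarrier (unitTorusGeo triangle254_unitTorusGeo rowSum_unitTorusGeo unitTorusGeo_dist_self)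
open Literature.MathematicalPhysics.QuantumFieldTheory.Balaban1983to89.T4EtaRateDefect (idef idef_sub)
open Literature.MathematicalPhysics.QuantumFieldTheory.Balaban1983to89.T4EtaRateCoeffDefect (pull diagK hasMaj_mulOp hasMaj_idef_mulOp diagK_le_decay)
open Summit.QuantumFields.YangMills.BalabanUVNodes.N15.VectorPiece (bshiftEquiv kingPrV blkFine blkFine_comp_kingPrV)
open Summit.QuantumFields.YangMills.BalabanUVNodes.N15.Gluing (lapOp deltaOp_eq_lapOp_zero_add hasMaj_nonlocalPart hasMaj_rate_le hasMaj_localize_sandwich hasMaj_localize_idef_sandwich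
  hasMaj_idef_mulOp_comp_loc hasMaj_diag_comp)

variable {d : ℕ}

/-! ## §1 The cube-interior weight and the entry-3 identity on the big torus -/

section Identity

variable (n : ℕ) [NeZero n] {M M' : Fin (d + 1) → ℕ} [∀ μ, NeZero (M μ)] [∀ μ, NeZero (M' μ)] (hM : ∀ μ, M' μ ∣ M μ) (c : Tor M) (S : ℕ)

omit [∀ μ, NeZero (M' μ)] in
/-- a weight supported on the cube's interior bonds does not see the cube's cut: `M_h ∘ M_{χ_□} = M_h`. [folklore] -/
theorem mulOp_comp_mulOp_chiCube_of_intBonds {h : Tor (fine n M) × Fin (d + 1) → ℝ} (hh : ∀ b, h b ≠ 0 → b ∈ intBonds M n c S) :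
    mulOp h ∘ₗ mulOp (chiCube M n c S) = mulOp h := by
  refine LinearMap.ext fun f => funext fun b => ?_
  simp only [LinearMap.comp_apply, mulOp_apply]
  by_cases hb : h b = 0
  · simp only [hb, zero_mul]
  · rw [chiCube_eq_ite, if_pos (mem_cubeW_of_mem_intBonds (hh b hb)), one_mul]

omit [∀ μ, NeZero (M' μ)] in
/-- the cut sandwich of a cube-interior weight: `M_{χ_□} ∘ M_h ∘ M_{χ_□} = M_h`. [folklore] -/
theorem mulOp_chiCube_sandwich_of_intBonds {h : Tor (fine n M) × Fin (d + 1) → ℝ} (hh : ∀ b, h b ≠ 0 → b ∈ intBonds M n c S) :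
    mulOp (chiCube M n c S) ∘ₗ mulOp h ∘ₗ mulOp (chiCube M n c S) = mulOp h := by
  refine LinearMap.ext fun f => funext fun b => ?_
  simp only [LinearMap.comp_apply, mulOp_apply]
  by_cases hb : h b = 0
  · simp only [hb, zero_mul, mul_zero]
  · rw [chiCube_eq_ite, if_pos (mem_cubeW_of_mem_intBonds (hh b hb)), one_mul, one_mul]

omit [∀ μ, NeZero (M' μ)] in
/-- the blocks of the support of a cube-interior weight lie in the cube. [folklore] -/
theorem blockOf_mem_cubeBlocks_of_intBonds {h : Tor (fine n M) × Fin (d + 1) → ℝ} (hh : ∀ b, h b ≠ 0 → b ∈ intBonds M n c S)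
    (b : Tor (fine n M) × Fin (d + 1)) (hb : h b ≠ 0) : blockOf n M b.1 ∈ ((cubeBlocks M c S : Finset (Tor M)) : Set (Tor M)) :=
  Finset.mem_coe.mpr ((mem_cubeW b).mp (mem_cubeW_of_mem_intBonds (hh b hb)))

/-- ★★ **THE ENTRY-3 IDENTITY ON THE BIG TORUS**: `M_h∘(Σ_μ∇*_μ∇_μ)∘G^{↑}(□ + c) = M_h − M_h∘(M_{χ_□}∘N_L∘G^{↑}(□ + c))` for a weight `h` supported on the interior bonds of the side-`S` cube
`□ + c` of `Tor (fine n M)` (`M′_ν = 2S ∣ M_ν`, `n ≥ 1`, `a > 0`; `N_L = a•Q*Q − ∂Π∂*`): `Σ∇*∇ = Δ_a − N_L` (FILE 69), the EXACT locality `M_hΔ_aG^{↑}(□) = M_h` of the lift (P-IIb) and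
`M_h = M_hM_{χ_□}`. [cite: Balaban1984PropagatorsII, (2.37)–(2.38) p.229, (2.91) p.239; Balaban1984PropagatorsI, (1.69) p.29] -/
theorem mulOp_comp_lapOp_comp_liftCubeG (hM2 : ∀ ν, M' ν = 2 * S) (hn : 1 ≤ n) {a : ℝ} (ha : 0 < a) {h : Tor (fine n M) × Fin (d + 1) → ℝ}
    (hh : ∀ b, h b ≠ 0 → b ∈ intBonds M n c S) :
    mulOp h ∘ₗ (lapOp (n : ℝ) (bshiftEquiv M n) 0 ∘ₗ liftCubeG n hM c S a) =
      mulOp h - mulOp h ∘ₗ (mulOp (chiCube M n c S) ∘ₗ (a • (qvAdjRe M n ∘ₗ qvRe M n) + (-landauRe M n)) ∘ₗ liftCubeG n hM c S a) := by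
  have hlap : lapOp (n : ℝ) (bshiftEquiv M n) 0 = deltaOp M n a - (a • (qvAdjRe M n ∘ₗ qvRe M n) + (-landauRe M n)) :=
    eq_sub_of_add_eq (deltaOp_eq_lapOp_zero_add (M := M) (n := n) a).symm
  have hloc := mulOp_comp_deltaOp_comp_liftCubeG n hM c S a hM2 hn ha hh
  have hcut := mulOp_comp_mulOp_chiCube_of_intBonds n c S hh
  rw [hlap, LinearMap.sub_comp, LinearMap.comp_sub, hloc]
  congr 1
  rw [← LinearMap.comp_assoc ((a • (qvAdjRe M n ∘ₗ qvRe M n) + (-landauRe M n)) ∘ₗ liftCubeG n hM c S a) (mulOp (chiCube M n c S)) (mulOp h), hcut]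

end Identity

/-! ## §2 The weighted entry-3 row of the lifted cube -/

section Row

variable {L : ℕ} (n : ℕ) [NeZero n] {M M' : Fin (d + 1) → ℕ} [∀ μ, NeZero (M μ)] [∀ μ, NeZero (M' μ)] (hM : ∀ μ, M' μ ∣ M μ) (c : Tor M) (S : ℕ) {kk : ℕ}

omit [∀ μ, NeZero (M' μ)] in
/-- ★ a cube-interior weight with `|h| ≤ 1` is two-sided localized on its cube: `M_h ≤ 1_□(y)1_□(y′)·(1·e^{−δ|y−y′|_T})`, any real `δ` (diagonal kernel; FILE 47
`hasMaj_localize_sandwich`). [folklore] -/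
theorem hasMaj_mulOp_loc_of_intBonds {h : Tor (fine n M) × Fin (d + 1) → ℝ} (hh : ∀ b, h b ≠ 0 → b ∈ intBonds M n c S) (hh1 : ∀ b, |h b| ≤ 1) (δ : ℝ) :
    HasMaj (BlockNorm.ofBlocks (unitTorusGeo L kk M) (fun b : Tor (fine n M) × Fin (d + 1) => blockOf n M b.1))
      (BlockNorm.ofBlocks (unitTorusGeo L kk M) (fun b : Tor (fine n M) × Fin (d + 1) => blockOf n M b.1)) (mulOp h)
      (fun y y' => ind ((cubeBlocks M c S : Finset (Tor M)) : Set (Tor M)) y * ind ((cubeBlocks M c S : Finset (Tor M)) : Set (Tor M)) y' * (1 * Real.exp (-(δ * tdistT M y y')))) := by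
  have h1 : ∀ x : Tor (fine n M) × Fin (d + 1), chiCube M n c S x ≠ 0 → blockOf n M x.1 ∈ ((cubeBlocks M c S : Finset (Tor M)) : Set (Tor M)) := fun x hx => by
    unfold chiCube at hx
    by_contra hb
    exact hx (if_neg (fun hmem => hb (Finset.mem_coe.mpr hmem)))
  have hR : HasMaj (BlockNorm.ofBlocks (unitTorusGeo L kk M) (fun b : Tor (fine n M) × Fin (d + 1) => blockOf n M b.1))
      (BlockNorm.ofBlocks (unitTorusGeo L kk M) (fun b : Tor (fine n M) × Fin (d + 1) => blockOf n M b.1)) (mulOp h) (fun y y' => 1 * Real.exp (-(δ * tdistT M y y'))) := by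
    refine (hasMaj_mulOp (g := unitTorusGeo L kk M) (fun b : Tor (fine n M) × Fin (d + 1) => blockOf n M b.1) (a := h) (m := fun _ => (1 : ℝ)) (fun _ => zero_le_one) hh1).mono
      fun y y' => ?_
    have e := diagK_le_decay (g := unitTorusGeo L kk M) (o := fun _ => (1 : ℝ)) (w := fun _ => (1 : ℝ)) (ε := 1) δ (fun _ => zero_le_one) (fun _ => by norm_num)
      (unitTorusGeo_dist_self L kk M) y y'
    simpa using e
  exact hasMaj_localize_sandwich (g := unitTorusGeo L kk M) (fun b : Tor (fine n M) × Fin (d + 1) => blockOf n M b.1) (fun b : Tor (fine n M) × Fin (d + 1) => blockOf n M b.1)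
    (fun y y' => mul_nonneg zero_le_one (Real.exp_nonneg _)) (mulOp_chiCube_sandwich_of_intBonds n c S hh) h1 h1 hR

/-- ★★ **THE WEIGHTED ENTRY-3 ROW OF THE LIFTED CUBE, LETTERS DISPLAYED** (any spacing `n ≥ 1`, `M′_ν = 2S ∣ M_ν`, `a > 0`): from the cube-torus letter `G′ ≤ Ce^{−δ₀d′}`, the
big-torus letter `N_L = a•Q*Q − ∂Π∂* ≤ c_Ne^{−ρ₁d}`, a row sum `c_r` of the big torus at `σ` and `ρ ≤ δ₀`, `ρ + σ ≤ ρ₁`, for every weight `h` on the interior bonds with `|h| ≤ 1`: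
`M_h∘(Σ∇*∇)∘G^{↑}(□ + c) ≤ 1_□(y)1_□(y′)·(1 + 2^{d+1}c_N(Ce^{δ₀})c_r)·e^{−ρ|y−y′|_T}` — §1's identity, the localized weight and P-IIe (β′) `hasMaj_chiCube_comp_liftCubeG_of` with `T₁ := N_L`.
[cite: Balaban1984PropagatorsII, (2.37) p.229, (2.133)–(2.134) p.247 (shapes); Balaban1984PropagatorsI, Prop. 1.2 (1.110) p.35, (1.126) p.38] -/
theorem hasMaj_mulOp_lap_liftCubeG_of (hM2 : ∀ ν, M' ν = 2 * S) (hn : 1 ≤ n) {a : ℝ} (ha : 0 < a) {h : Tor (fine n M) × Fin (d + 1) → ℝ}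
    (hh : ∀ b, h b ≠ 0 → b ∈ intBonds M n c S) (hh1 : ∀ b, |h b| ≤ 1) {C δ₀ cN ρ₁ ρ σ cr : ℝ} (hrow : RowSum (unitTorusGeo L kk M) σ cr) (hC : 0 ≤ C) (hδ₀ : 0 ≤ δ₀)
    (hcN : 0 ≤ cN) (hρ : 0 ≤ ρ) (hρδ : ρ ≤ δ₀) (hρσ : ρ + σ ≤ ρ₁)
    (hG' : HasMaj (BlockNorm.ofBlocks (unitTorusGeo L kk M') (fun b : Tor (fine n M') × Fin (d + 1) => blockOf n M' b.1))
      (BlockNorm.ofBlocks (unitTorusGeo L kk M') (fun b : Tor (fine n M') × Fin (d + 1) => blockOf n M' b.1)) (gOp M' n a) (fun y y' => C * Real.exp (-(δ₀ * tdistT M' y y'))))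
    (hNL : HasMaj (BlockNorm.ofBlocks (unitTorusGeo L kk M) (fun b : Tor (fine n M) × Fin (d + 1) => blockOf n M b.1))
      (BlockNorm.ofBlocks (unitTorusGeo L kk M) (fun b : Tor (fine n M) × Fin (d + 1) => blockOf n M b.1)) (a • (qvAdjRe M n ∘ₗ qvRe M n) + (-landauRe M n))
      (fun y y' => cN * Real.exp (-(ρ₁ * tdistT M y y')))) :
    HasMaj (BlockNorm.ofBlocks (unitTorusGeo L kk M) (fun b : Tor (fine n M) × Fin (d + 1) => blockOf n M b.1))
      (BlockNorm.ofBlocks (unitTorusGeo L kk M) (fun b : Tor (fine n M) × Fin (d + 1) => blockOf n M b.1))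
      (mulOp h ∘ₗ (lapOp (n : ℝ) (bshiftEquiv M n) 0 ∘ₗ liftCubeG n hM c S a))
      (fun y y' => ind ((cubeBlocks M c S : Finset (Tor M)) : Set (Tor M)) y * ind ((cubeBlocks M c S : Finset (Tor M)) : Set (Tor M)) y' *
        ((1 + 2 ^ (d + 1) * (cN * (C * Real.exp δ₀) * cr)) * Real.exp (-(ρ * tdistT M y y')))) := by
  have h1 := hasMaj_mulOp_loc_of_intBonds (L := L) (kk := kk) n c S hh hh1 ρ
  have hY := hasMaj_chiCube_comp_liftCubeG_of n hM c S hM2 (triangle254_unitTorusGeo L kk M') hrow hC hδ₀ hcN hρ hρδ hρσ hNL hG'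
  have hMh := hasMaj_mulOp (g := unitTorusGeo L kk M) (fun b : Tor (fine n M) × Fin (d + 1) => blockOf n M b.1) (a := h) (m := fun _ => (1 : ℝ)) (fun _ => zero_le_one) hh1
  have h2 := hasMaj_diag_comp (g := unitTorusGeo L kk M) (fun b : Tor (fine n M) × Fin (d + 1) => blockOf n M b.1) (fun _ => zero_le_one) hMh hY
  rw [mulOp_comp_lapOp_comp_liftCubeG n hM c S hM2 hn ha hh]
  refine (h1.sub h2).mono fun y y' => le_of_eq ?_
  ring

variable [NeZero L]

/-- ★★★ **THE WEIGHTED ENTRY-3 ROWS OF THE LIFTED CUBES ON THE TORUS FAMILY OF RECORD, BOTH SPACINGS, EVERY LETTER DISCHARGED, UNIFORM IN THE VOLUME**: for odd `L ≥ 3` and `a > 0`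
there are `δ, β₃ > 0` such that for every cube exponent `s`, volume exponent `m_T ≥ s`, coarse level `K ≥ 1`, refinement `r`, corner `c` of the torus of record
`M = MP (paramsOf d L m_T K hL)` (`M_ν = 2L^{m_T}`; cube torus `MP (paramsOf d L s K hL)`, `G^{↑} = liftCubeG · (MP_dvd_MP hL hs K) c (L^s) a`) and every weight `h` on the interior bonds with
`|h| ≤ 1`: `M_h∘(Σ∇*∇)∘G^{↑}(□ + c) ≤ 1_□(y)1_□(y′)·β₃·e^{−δ|y−y′|_T}` at the spacing `L^{−K}` AND at the spacing `L^{−(K+r)}` (blocks read through King's pairing) — the cube-torus letter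
from [B5] Prop. 1.2 (1.110) AT THE CUBE TORUS (`ineq110_114_pair`, both spacings), the big torus entering only through `∂Π∂*`'s letter (`hasMaj_landauRe`) and `Q*Q`'s stencil.
[cite: Balaban1984PropagatorsII, (2.37) p.229, p.238 (T_□), (2.133)–(2.134) p.247; Balaban1984PropagatorsI, Prop. 1.2 (1.110) p.35, (1.69) p.29, (1.126) p.38] -/
theorem hasMaj_mulOp_lap_liftCubeG_pair (hL : Odd L ∧ 1 < L) {a : ℝ} (ha : 0 < a) :
    ∃ δ β₃ : ℝ, 0 < δ ∧ 0 < β₃ ∧ ∀ (s mT K r : ℕ) (hs : s ≤ mT) (hK : 1 ≤ K) (c : Tor (MP (paramsOf d L mT K hL))),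
      (∀ (h : Tor (fine (L ^ K) (MP (paramsOf d L mT K hL))) × Fin (d + 1) → ℝ), (∀ b, h b ≠ 0 → b ∈ intBonds (MP (paramsOf d L mT K hL)) (L ^ K) c (L ^ s)) → (∀ b, |h b| ≤ 1) →
        HasMaj (BlockNorm.ofBlocks (unitTorusGeo L K (MP (paramsOf d L mT K hL))) (blkFine L K (MP (paramsOf d L mT K hL))))
          (BlockNorm.ofBlocks (unitTorusGeo L K (MP (paramsOf d L mT K hL))) (blkFine L K (MP (paramsOf d L mT K hL))))
          (mulOp h ∘ₗ (lapOp ((L ^ K : ℕ) : ℝ) (bshiftEquiv (MP (paramsOf d L mT K hL)) (L ^ K)) 0 ∘ₗ liftCubeG (L ^ K) (MP_dvd_MP hL hs K) c (L ^ s) a))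
          (fun y y' => ind ((cubeBlocks (MP (paramsOf d L mT K hL)) c (L ^ s) : Finset _) : Set _) y * ind ((cubeBlocks (MP (paramsOf d L mT K hL)) c (L ^ s) : Finset _) : Set _) y' *
            (β₃ * Real.exp (-(δ * tdistT (MP (paramsOf d L mT K hL)) y y'))))) ∧
      (∀ (h' : Tor (fine (L ^ r * L ^ K) (MP (paramsOf d L mT K hL))) × Fin (d + 1) → ℝ),
        (∀ b, h' b ≠ 0 → b ∈ intBonds (MP (paramsOf d L mT K hL)) (L ^ r * L ^ K) c (L ^ s)) → (∀ b, |h' b| ≤ 1) →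
        HasMaj (BlockNorm.ofBlocks (unitTorusGeo L K (MP (paramsOf d L mT K hL)))
            (fun i : Tor (fine (L ^ r * L ^ K) (MP (paramsOf d L mT K hL))) × Fin (d + 1) => blockOf (L ^ r * L ^ K) (MP (paramsOf d L mT K hL)) i.1))
          (BlockNorm.ofBlocks (unitTorusGeo L K (MP (paramsOf d L mT K hL)))
            (fun i : Tor (fine (L ^ r * L ^ K) (MP (paramsOf d L mT K hL))) × Fin (d + 1) => blockOf (L ^ r * L ^ K) (MP (paramsOf d L mT K hL)) i.1))
          (mulOp h' ∘ₗ (lapOp ((L ^ r * L ^ K : ℕ) : ℝ) (bshiftEquiv (MP (paramsOf d L mT K hL)) (L ^ r * L ^ K)) 0 ∘ₗ liftCubeG (L ^ r * L ^ K) (MP_dvd_MP hL hs K) c (L ^ s) a))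
          (fun y y' => ind ((cubeBlocks (MP (paramsOf d L mT K hL)) c (L ^ s) : Finset _) : Set _) y * ind ((cubeBlocks (MP (paramsOf d L mT K hL)) c (L ^ s) : Finset _) : Set _) y' *
            (β₃ * Real.exp (-(δ * tdistT (MP (paramsOf d L mT K hL)) y y'))))) := by
  have hLpos : 0 < L := by have := hL.2; omega
  obtain ⟨δ₀, C, Cα, Cε, Cαε, hδ₀, hC, H⟩ := ineq110_114_pair (d := d) hL ha
  obtain ⟨δ₁, C₁, hδ₁, hC₁, HL⟩ := hasMaj_landauRe (d := d) (L := L)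
  set δm : ℝ := min δ₀ δ₁ with hδm_def
  have hδm : 0 < δm := lt_min hδ₀ hδ₁
  set cr : ℝ := B4Sect5Proof.latticeConst (d + 1) (δm / 4) with hcr_def
  have hcr : 0 ≤ cr := B4Sect5Proof.latticeConst_nonneg (d + 1) (by positivity)
  set cN : ℝ := |a| * (Real.exp δm * Real.exp δm) + C₁ with hcN_def
  have hcN : 0 ≤ cN := by positivity
  refine ⟨δm / 2, 1 + 2 ^ (d + 1) * (cN * (C * Real.exp δ₀) * cr), by positivity, by positivity, fun s mT K r hs hK => ?_⟩
  -- (`set` before `intro c`: the corner's type must not be rewritten under a live goal dependence)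
  set M : Fin (d + 1) → ℕ := MP (paramsOf d L mT K hL) with hMdef
  intro c
  have hM' : ∀ ν, MP (paramsOf d L s K hL) ν = 2 * L ^ s := fun ν => rfl
  have hn : 1 ≤ L ^ K := Nat.one_le_pow _ _ hLpos
  have hn' : 1 ≤ L ^ r * L ^ K := Nat.one_le_iff_ne_zero.mpr (Nat.mul_ne_zero (pow_ne_zero r (NeZero.ne L)) (pow_ne_zero K (NeZero.ne L)))
  have hrow := rowSum_unitTorusGeo (L := L) (k := K) (M := M) (σ := δm / 4) (by positivity)
  have hρδ : δm / 2 ≤ δ₀ := by linarith [min_le_left δ₀ δ₁, hδm.le]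
  have hρσ : δm / 2 + δm / 4 ≤ δm := by linarith [hδm.le]
  refine ⟨fun h hh hh1 => ?_, fun h' hh' hh1' => ?_⟩
  · have hG' := hasMaj_gOp_of_ineq (L := L) (k := K) (MP (paramsOf d L s K hL)) (L ^ K) a hn (H s K r hK).1 hC.le
    have hNL := hasMaj_nonlocalPart (L := L) (kk := K) (M := M) (n := L ^ K) (a := a) hC₁.le hδm.le (min_le_right δ₀ δ₁) (HL K (L ^ K) M)
    exact hasMaj_mulOp_lap_liftCubeG_of (L := L) (kk := K) (L ^ K) (MP_dvd_MP hL hs K) c (L ^ s) hM' hn ha hh hh1 hrow hC.le hδ₀.le hcN (by positivity) hρδ hρσ hG' hNL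
  · have hG' := hasMaj_gOp_of_ineq (L := L) (k := K) (MP (paramsOf d L s K hL)) (L ^ r * L ^ K) a hn' (H s K r hK).2 hC.le
    have hNL := hasMaj_nonlocalPart (L := L) (kk := K) (M := M) (n := L ^ r * L ^ K) (a := a) hC₁.le hδm.le (min_le_right δ₀ δ₁) (HL K (L ^ r * L ^ K) M)
    exact hasMaj_mulOp_lap_liftCubeG_of (L := L) (kk := K) (L ^ r * L ^ K) (MP_dvd_MP hL hs K) c (L ^ s) hM' hn' ha hh' hh1' hrow hC.le hδ₀.le hcN (by positivity) hρδ hρσ hG' hNL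

end Row

/-! ## §3 The two-grid η-defect of the weighted entry-3 row of the lifted cube -/

section Defect

variable {L : ℕ} [NeZero L]

/-- ★★★ **THE TWO-GRID η-DEFECT OF THE WEIGHTED ENTRY-3 ROW OF A LIFTED CUBE ON THE TORUS FAMILY OF RECORD, UNIFORM IN THE VOLUME**: for odd `L ≥ 3`, `a > 0`, `0 < γ < 1` there are
`δ, m₃ > 0` such that for every `s ≤ m_T`, `K ≥ 1`, `r`, corner `c` of `M = MP (paramsOf d L m_T K hL)`, every coarse weight `h` (spacing `L^{−K}`) and fine weight `h′` (spacing `L^{−(K+r)}`)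
on the interior bonds of `□ + c` with `|h|, |h′| ≤ 1` and the fit `|h′(x′) − h(Px′)| ≤ o` (`o ≥ 0`, `P` = King's pairing of bonds):
`𝔇(M_{h′}∘(Σ∇′*∇′)∘G′^{↑}(□ + c), M_h∘(Σ∇*∇)∘G^{↑}(□ + c)) ≤ 1_□(y)1_□(y′)·m₃·(o + (L^K)^{−γ∕2})·e^{−δ|y−y′|_T}` — §1's identity at both spacings, `𝔇(M_{h′}, M_h) ≤ o` localized (FILE 47
`hasMaj_localize_idef_sandwich`), and FILE 46 `hasMaj_idef_mulOp_comp_loc` on P-IIe's coarse row `χ_□N_LG^{↑}` and P-IIi's defect `𝔇(χ′_□N′_LG′^{↑}, χ_□N_LG^{↑}) ≤ 1_□1_□m(L^K)^{−γ∕2}e^{−δd}`.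
[cite: Balaban1984PropagatorsII, (2.37)–(2.38) p.229, (2.133)–(2.136) p.247 (shapes); Balaban1985BackgroundPropagators, Thm 3.14 pp.426–427 (difference template), (3.42) p.397 (entry 3:
shape); Balaban1984PropagatorsI, Prop. 1.2 (1.110) p.35, (1.126) p.38] -/
theorem hasMaj_idef_mulOp_lap_liftCubeG (hL : Odd L ∧ 1 < L) {a : ℝ} (ha : 0 < a) {γ : ℝ} (hγ0 : 0 < γ) (hγ1 : γ < 1) :
    ∃ δ m₃ : ℝ, 0 < δ ∧ 0 < m₃ ∧ ∀ (s mT K r : ℕ) (hs : s ≤ mT) (hK : 1 ≤ K) (c : Tor (MP (paramsOf d L mT K hL)))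
      (h : Tor (fine (L ^ K) (MP (paramsOf d L mT K hL))) × Fin (d + 1) → ℝ) (h' : Tor (fine (L ^ r * L ^ K) (MP (paramsOf d L mT K hL))) × Fin (d + 1) → ℝ) {o : ℝ} (ho : 0 ≤ o)
      (hh : ∀ b, h b ≠ 0 → b ∈ intBonds (MP (paramsOf d L mT K hL)) (L ^ K) c (L ^ s)) (hh1 : ∀ b, |h b| ≤ 1)
      (hh' : ∀ b, h' b ≠ 0 → b ∈ intBonds (MP (paramsOf d L mT K hL)) (L ^ r * L ^ K) c (L ^ s)) (hh1' : ∀ b, |h' b| ≤ 1)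
      (hfit : ∀ x', |h' x' - h (kingPrV L K r (MP (paramsOf d L mT K hL)) x')| ≤ o),
      HasMaj (BlockNorm.ofBlocks (unitTorusGeo L K (MP (paramsOf d L mT K hL))) (blkFine L K (MP (paramsOf d L mT K hL))))
        (BlockNorm.ofBlocks (unitTorusGeo L K (MP (paramsOf d L mT K hL)))
          (fun i : Tor (fine (L ^ r * L ^ K) (MP (paramsOf d L mT K hL))) × Fin (d + 1) => blockOf (L ^ r * L ^ K) (MP (paramsOf d L mT K hL)) i.1))
        (idef (pull (kingPrV L K r (MP (paramsOf d L mT K hL)))) (pull (kingPrV L K r (MP (paramsOf d L mT K hL))))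
          (mulOp h' ∘ₗ (lapOp ((L ^ r * L ^ K : ℕ) : ℝ) (bshiftEquiv (MP (paramsOf d L mT K hL)) (L ^ r * L ^ K)) 0 ∘ₗ liftCubeG (L ^ r * L ^ K) (MP_dvd_MP hL hs K) c (L ^ s) a))
          (mulOp h ∘ₗ (lapOp ((L ^ K : ℕ) : ℝ) (bshiftEquiv (MP (paramsOf d L mT K hL)) (L ^ K)) 0 ∘ₗ liftCubeG (L ^ K) (MP_dvd_MP hL hs K) c (L ^ s) a)))
        (fun y y' => ind ((cubeBlocks (MP (paramsOf d L mT K hL)) c (L ^ s) : Finset _) : Set _) y * ind ((cubeBlocks (MP (paramsOf d L mT K hL)) c (L ^ s) : Finset _) : Set _) y' *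
          (m₃ * (o + ((L ^ K : ℕ) : ℝ) ^ (-(γ / 2))) * Real.exp (-(δ * tdistT (MP (paramsOf d L mT K hL)) y y')))) := by
  have hL2 : 2 ≤ L := by have := hL.2; omega
  have hLpos : 0 < L := by omega
  obtain ⟨δ₀, C, Cα, Cε, Cαε, hδ₀, hC, H⟩ := ineq110_114_pair (d := d) hL ha
  obtain ⟨δ₁, C₁, hδ₁, hC₁, HL⟩ := hasMaj_landauRe (d := d) (L := L)
  obtain ⟨δY, mY, hδY, hmY, HY⟩ := hasMaj_idef_chiCube_nonlocal_liftCubeG (d := d) hL.1 hL2 ha hγ0 hγ1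
  set δm : ℝ := min δ₀ δ₁ with hδm_def
  have hδm : 0 < δm := lt_min hδ₀ hδ₁
  set δ : ℝ := min (δm / 2) δY with hδ_def
  have hδ : 0 < δ := lt_min (by positivity) hδY
  have hdm : δ ≤ δm / 2 := min_le_left _ _
  have hdY : δ ≤ δY := min_le_right _ _
  set cr : ℝ := B4Sect5Proof.latticeConst (d + 1) (δm / 4) with hcr_def
  have hcr : 0 ≤ cr := B4Sect5Proof.latticeConst_nonneg (d + 1) (by positivity)
  set cN : ℝ := |a| * (Real.exp δm * Real.exp δm) + C₁ with hcN_def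
  have hcN : 0 ≤ cN := by positivity
  set βY : ℝ := 2 ^ (d + 1) * (cN * (C * Real.exp δ₀) * cr) with hβY_def
  have hβY : 0 ≤ βY := by positivity
  refine ⟨δ, 1 + βY + mY, hδ, by positivity, fun s mT K r hs hK => ?_⟩
  set M : Fin (d + 1) → ℕ := MP (paramsOf d L mT K hL) with hMdef
  intro c h h' o ho hh hh1 hh' hh1' hfit
  -- the periodisation, typed over the abbreviation `M` (keeps every operator below syntactically on `M`)
  have hMd : ∀ μ, MP (paramsOf d L s K hL) μ ∣ M μ := MP_dvd_MP hL hs K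
  have hM' : ∀ ν, MP (paramsOf d L s K hL) ν = 2 * L ^ s := fun ν => rfl
  have hn : 1 ≤ L ^ K := Nat.one_le_pow _ _ hLpos
  have hn' : 1 ≤ L ^ r * L ^ K := Nat.one_le_iff_ne_zero.mpr (Nat.mul_ne_zero (pow_ne_zero r (NeZero.ne L)) (pow_ne_zero K (NeZero.ne L)))
  set ε : ℝ := ((L ^ K : ℕ) : ℝ) ^ (-(γ / 2)) with hε_def
  have hε0 : 0 ≤ ε := Real.rpow_nonneg (Nat.cast_nonneg _) _
  have hrow := rowSum_unitTorusGeo (L := L) (k := K) (M := M) (σ := δm / 4) (by positivity)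
  have hblk : (fun i : Tor (fine (L ^ r * L ^ K) M) × Fin (d + 1) => blockOf (L ^ r * L ^ K) M i.1) = blkFine L K M ∘ kingPrV L K r M := (blkFine_comp_kingPrV (M := M) L K r).symm
  have hind : ∀ y y' : Tor M, 0 ≤ ind (g := unitTorusGeo L K M) ((cubeBlocks M c (L ^ s) : Finset (Tor M)) : Set (Tor M)) y *
      ind (g := unitTorusGeo L K M) ((cubeBlocks M c (L ^ s) : Finset (Tor M)) : Set (Tor M)) y' := fun y y' => mul_nonneg (ind_nonneg _ _) (ind_nonneg _ _)
  -- the two identities (§1) at the fine and the coarse spacing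
  have E := congrArg₂ (idef (pull (kingPrV L K r M)) (pull (kingPrV L K r M)))
    (mulOp_comp_lapOp_comp_liftCubeG (L ^ r * L ^ K) hMd c (L ^ s) hM' hn' ha hh')
    (mulOp_comp_lapOp_comp_liftCubeG (L ^ K) hMd c (L ^ s) hM' hn ha hh)
  -- supports of the two cube cuts
  have h1 : ∀ x : Tor (fine (L ^ K) M) × Fin (d + 1), chiCube M (L ^ K) c (L ^ s) x ≠ 0 → blkFine L K M x ∈ ((cubeBlocks M c (L ^ s) : Finset (Tor M)) : Set (Tor M)) :=
    fun x hx => by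
    unfold chiCube at hx
    by_contra hb
    exact hx (if_neg (fun hmem => hb (Finset.mem_coe.mpr hmem)))
  have h2 : ∀ x' : Tor (fine (L ^ r * L ^ K) M) × Fin (d + 1), chiCube M (L ^ r * L ^ K) c (L ^ s) x' ≠ 0 →
      (blkFine L K M ∘ kingPrV L K r M) x' ∈ ((cubeBlocks M c (L ^ s) : Finset (Tor M)) : Set (Tor M)) := fun x' hx => by
    rw [← hblk]
    unfold chiCube at hx
    by_contra hb
    exact hx (if_neg (fun hmem => hb (Finset.mem_coe.mpr hmem)))
  -- `𝔇(M_{h′}, M_h) ≤ o·e^{−δd}`, localized on the cube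
  have hR : HasMaj (BlockNorm.ofBlocks (unitTorusGeo L K M) (blkFine L K M)) (BlockNorm.ofBlocks (unitTorusGeo L K M) (blkFine L K M ∘ kingPrV L K r M))
      (idef (pull (kingPrV L K r M)) (pull (kingPrV L K r M)) (mulOp h') (mulOp h)) (fun y y' => o * Real.exp (-(δ * tdistT M y y'))) := by
    refine (hasMaj_idef_mulOp (g := unitTorusGeo L K M) (blkFine L K M) (kingPrV L K r M) (o := fun _ => o) (fun _ => ho) hfit).mono fun y y' => ?_
    have e := diagK_le_decay (g := unitTorusGeo L K M) (o := fun _ => o) (w := fun _ => (1 : ℝ)) (ε := o) δ (fun _ => ho) (fun _ => by rw [mul_one]) (unitTorusGeo_dist_self L K M) y y'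
    simpa using e
  have t1 := hasMaj_localize_idef_sandwich (g := unitTorusGeo L K M) (blkFine L K M) (kingPrV L K r M) (fun y y' => mul_nonneg ho (Real.exp_nonneg _))
    (mulOp_chiCube_sandwich_of_intBonds (L ^ K) c (L ^ s) hh) (mulOp_chiCube_sandwich_of_intBonds (L ^ r * L ^ K) c (L ^ s) hh') h1 h2 hR
  -- the coarse row `χ_□N_LG^{↑} ≤ 1_□1_□·βY·e^{−δd}` (P-IIe (β′)) and P-IIi's defect, rates weakened to `δ`
  have hG := hasMaj_gOp_of_ineq (L := L) (k := K) (MP (paramsOf d L s K hL)) (L ^ K) a hn (H s K r hK).1 hC.le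
  have hNL := hasMaj_nonlocalPart (L := L) (kk := K) (M := M) (n := L ^ K) (a := a) hC₁.le hδm.le (min_le_right δ₀ δ₁) (HL K (L ^ K) M)
  have hYc : HasMaj (BlockNorm.ofBlocks (unitTorusGeo L K M) (blkFine L K M)) (BlockNorm.ofBlocks (unitTorusGeo L K M) (blkFine L K M))
      (mulOp (chiCube M (L ^ K) c (L ^ s)) ∘ₗ (a • (qvAdjRe M (L ^ K) ∘ₗ qvRe M (L ^ K)) + (-landauRe M (L ^ K))) ∘ₗ liftCubeG (L ^ K) hMd c (L ^ s) a)
      (fun y y' => ind ((cubeBlocks M c (L ^ s) : Finset (Tor M)) : Set (Tor M)) y * ind ((cubeBlocks M c (L ^ s) : Finset (Tor M)) : Set (Tor M)) y' * (βY * Real.exp (-(δ * tdistT M y y')))) :=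
    hasMaj_rate_le hind hβY hdm
      (hasMaj_chiCube_comp_liftCubeG_of (L ^ K) hMd c (L ^ s) hM' (triangle254_unitTorusGeo L K _) hrow hC.le hδ₀.le hcN (by positivity : 0 ≤ δm / 2)
        (by linarith [min_le_left δ₀ δ₁, hδm.le] : δm / 2 ≤ δ₀) (by linarith [hδm.le] : δm / 2 + δm / 4 ≤ δm) hNL hG)
  have hIY : HasMaj (BlockNorm.ofBlocks (unitTorusGeo L K M) (blkFine L K M)) (BlockNorm.ofBlocks (unitTorusGeo L K M) (blkFine L K M ∘ kingPrV L K r M))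
      (idef (pull (kingPrV L K r M)) (pull (kingPrV L K r M))
        (mulOp (chiCube M (L ^ r * L ^ K) c (L ^ s)) ∘ₗ (a • (qvAdjRe M (L ^ r * L ^ K) ∘ₗ qvRe M (L ^ r * L ^ K)) + (-landauRe M (L ^ r * L ^ K))) ∘ₗ
          liftCubeG (L ^ r * L ^ K) hMd c (L ^ s) a)
        (mulOp (chiCube M (L ^ K) c (L ^ s)) ∘ₗ (a • (qvAdjRe M (L ^ K) ∘ₗ qvRe M (L ^ K)) + (-landauRe M (L ^ K))) ∘ₗ liftCubeG (L ^ K) hMd c (L ^ s) a))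
      (fun y y' => ind ((cubeBlocks M c (L ^ s) : Finset (Tor M)) : Set (Tor M)) y * ind ((cubeBlocks M c (L ^ s) : Finset (Tor M)) : Set (Tor M)) y' *
        (mY * ε * Real.exp (-(δ * tdistT M y y')))) := by
    have h0 := hasMaj_rate_le hind (by positivity : 0 ≤ mY * ε) hdY (HY s mT K r hK hL hs c)
    rw [hblk] at h0
    exact h0
  have t2 := hasMaj_idef_mulOp_comp_loc (g := unitTorusGeo L K M) (blkFine L K M) (kingPrV L K r M) (a := h) (a' := h') zero_le_one ho hh1' hfit hYc hIY
  -- assembly (the difference is formed by `HasMaj.sub`, then folded by `idef_sub`)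
  have t := t1.sub t2
  rw [← idef_sub] at t
  have t' : HasMaj _ _ _ (fun y y' => ind ((cubeBlocks M c (L ^ s) : Finset (Tor M)) : Set (Tor M)) y * ind ((cubeBlocks M c (L ^ s) : Finset (Tor M)) : Set (Tor M)) y' *
      ((1 + βY + mY) * (o + ε) * Real.exp (-(δ * tdistT M y y')))) :=
    t.mono fun y y' => by
      have hI := hind y y'
      have hE := Real.exp_nonneg (-(δ * tdistT M y y'))
      have hb : o + (1 * (mY * ε) + o * βY) ≤ (1 + βY + mY) * (o + ε) := by nlinarith [hmY.le, hβY, ho, hε0]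
      calc ind (g := unitTorusGeo L K M) ((cubeBlocks M c (L ^ s) : Finset (Tor M)) : Set (Tor M)) y *
              ind (g := unitTorusGeo L K M) ((cubeBlocks M c (L ^ s) : Finset (Tor M)) : Set (Tor M)) y' * (o * Real.exp (-(δ * tdistT M y y'))) +
            ind (g := unitTorusGeo L K M) ((cubeBlocks M c (L ^ s) : Finset (Tor M)) : Set (Tor M)) y *
              ind (g := unitTorusGeo L K M) ((cubeBlocks M c (L ^ s) : Finset (Tor M)) : Set (Tor M)) y' * ((1 * (mY * ε) + o * βY) * Real.exp (-(δ * tdistT M y y')))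
          = ind (g := unitTorusGeo L K M) ((cubeBlocks M c (L ^ s) : Finset (Tor M)) : Set (Tor M)) y *
              ind (g := unitTorusGeo L K M) ((cubeBlocks M c (L ^ s) : Finset (Tor M)) : Set (Tor M)) y' * ((o + (1 * (mY * ε) + o * βY)) * Real.exp (-(δ * tdistT M y y'))) := by
            ring
        _ ≤ _ := mul_le_mul_of_nonneg_left (mul_le_mul_of_nonneg_right hb hE) hI
  rw [← hblk] at t'
  exact t'.congr fun f => (LinearMap.congr_fun E f).symm

end Defect

end Summit.QuantumFields.YangMills.BalabanUVNodes.N15.TwoGrid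

end
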